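import Mathlib.RingTheory.AdjoinRoot
import Mathlib.RingTheory.GradedAlgebra.Basic
import Mathlib.Algebra.DirectSum.Decomposition
import Mathlib.LinearAlgebra.DFinsupp
import Mathlib.Data.ZMod.Basic
import Mathlib.RingTheory.FiniteType
import HarnessLib

/-!
# Crux `FrobeniusLadder.FRationalResolution` (stmt-ResolutionOfSingularities-15317), line `redirect`,
# stub `stub_diagonalizableQuotientResolution` — item (F2) of MEMO-15317-leafhand2-g20 §3 (NON-FIXED chart points,
# wild NON-SPLIT case), ring level: the ROOT-ADJUNCTION chart `S̃ = S[w]/(w^d − u)` graded by `A × ℤ/d`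

When the unit-degree subgroup `B_𝔔` of a chart point is not a direct summand of `A` (`…FixedChartOfSummand` does not
apply; e.g. `pℤ/p² < ℤ/p²`), one first ENLARGES the chart: for a homogeneous `u ∈ S_b` and `a ∈ A`, `d ≥ 1` with
`d • a = b`, the ring `S̃ := S[w]/(w^d − u) = AdjoinRoot (X^d − C u)` is graded by `A × ZMod d` with
`deg (c w^j) = (deg c + j•a, j)` — well defined because `w^d = u` has bidegree `(b, 0) = (d•a, d mod d)`:

* `coeff_eq_zero_of_sum_eq_zero`, `exists_coeff` — every element of `S̃` is uniquely `∑_{j<d} c_j w^j`;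
* `exists_rootGrading` — the `GradedAlgebra` structure with pieces `S̃_{(i,m)} = S_{i − m•a} · w^{m}` (`0 ≤ m < d`)
  (existential package: pieces, structure, description);
* `of_mem`, `root_mem`, `root_pow_eq`, `isUnit_root` — `S_i ⊆ S̃_{(i,0)}`, `w ∈ S̃_{(a,1)}`, `w^d = u`, and `w` is
  a UNIT when `u` is: the unit degrees of `S̃` contain `B × 0` and `(a,1)`;
* `exists_ringEquiv_gradeZero` — **the invariants do not change: `S_0 ≃+* S̃_{(0,0)}`** (`of` is injective);
* `mem_of_forall_mem` — a piece `S̃_{(i,m)}` lies in a prime `𝔔̃` as soon as `S_{i − m•a} ⊆ 𝔔̃ ∩ S`;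
* `finiteType`, `module_finite`, `module_free`, `nontrivial` — `S̃` is free of rank `d` over `S`, of finite type.

With `C̃ = 0 × ZMod d`: `B̃ + C̃ = A × ZMod d` as soon as `B + ⟨a⟩ = A`, and `B̃ ∩ C̃ = 0` when `d` is the order of
`a` modulo `B`; so `…SummandChart` / `…FixedChartOfSummand` applied to `(A × ZMod d, S̃)` re-chart the point to a FIXED
point of `S̃^{(C̃)} = ⊕_m S_{−m•a} w^m` with invariants `S_0` — PROVIDED `S̃` is regular at the primes over `𝔔`
(automatic for `p ∤ d`; for `p ∣ d` and `u` a unit whose degree generates the `p`-part of `B_𝔔` this is the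
embedding-dimension count of MEMO-15317-leafhand2-g21 §3, not yet formalized). Honest label: helper toward ONE leaf
stub; no stub, crux or summit closed. No definitions, no named facts, no sorry.
[folklore; cite: SGA3, Exp. VIII §4–5] [cite: StacksProject, Tag 09EZ]
-/

noncomputable section

-- single-problem summit: the doubled namespace component is forced
set_option linter.dupNamespace false

open DirectSum Polynomial

namespace Summit.ResolutionOfSingularities.ResolutionOfSingularities.Theorems.FRationalResolution.RootAdjoinChart

universe u v w

variable {k : Type u} [CommRing k] {A : Type w} [DecidableEq A] [AddCommGroup A] {S : Type v}
  [CommRing S] [Algebra k S] (𝒮 : A → Submodule k S) [GradedAlgebra 𝒮]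
  (d : ℕ) [NeZero d] (u : S)

/-! ### Normal form in `S[w]/(w^d − u)` -/

/-- `(X^d − C u)` is monic. [folklore] -/
theorem monic : (X ^ d - C u : S[X]).Monic := monic_X_pow_sub_C u (NeZero.ne d)

omit [NeZero d] in
/-- `w^d = u` in `S̃ = S[w]/(w^d − u)`. [folklore] -/
theorem root_pow_eq :
    AdjoinRoot.root (X ^ d - C u : S[X]) ^ d = AdjoinRoot.of (X ^ d - C u : S[X]) u := by
  have h : AdjoinRoot.mk (X ^ d - C u : S[X]) (X ^ d - C u) = 0 := AdjoinRoot.mk_self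
  rw [map_sub, map_pow, AdjoinRoot.mk_X, AdjoinRoot.mk_C] at h
  exact sub_eq_zero.1 h

/-- `w` is a unit when `u` is. [folklore] -/
theorem isUnit_root (hu : IsUnit u) : IsUnit (AdjoinRoot.root (X ^ d - C u : S[X])) := by
  have h := hu.map (AdjoinRoot.of (X ^ d - C u : S[X]))
  rw [← root_pow_eq] at h
  exact (isUnit_pow_iff (NeZero.ne d)).1 h

/-- `of : S → S̃` is injective (monic modulus of positive degree). [folklore] -/
theorem of_injective [Nontrivial S] : Function.Injective (AdjoinRoot.of (X ^ d - C u : S[X])) := by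
  rw [injective_iff_map_eq_zero]
  intro c hc
  have hdvd : (X ^ d - C u : S[X]) ∣ C c := by
    rw [← AdjoinRoot.mk_eq_zero, AdjoinRoot.mk_C]; exact hc
  by_contra h0
  refine (monic d u).not_dvd_of_degree_lt (by rwa [Ne, map_eq_zero_iff C C_injective]) ?_ hdvd
  rw [degree_C h0, degree_X_pow_sub_C (Nat.pos_of_ne_zero (NeZero.ne d))]
  exact_mod_cast Nat.pos_of_ne_zero (NeZero.ne d)

/-- **Uniqueness of the normal form**: if `∑_{m} c_m w^{m} = 0` (`0 ≤ m < d`) then all `c_m = 0`.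
[folklore] -/
theorem coeff_eq_zero_of_sum_eq_zero [Nontrivial S] (c : ZMod d → S)
    (h : ∑ m : ZMod d, AdjoinRoot.of (X ^ d - C u : S[X]) (c m) * AdjoinRoot.root (X ^ d - C u : S[X]) ^ m.val = 0) :
    ∀ m, c m = 0 := by
  set P : S[X] := X ^ d - C u with hP
  let q : S[X] := ∑ m : ZMod d, C (c m) * X ^ m.val
  have hq : AdjoinRoot.mk P q = 0 := by
    rw [← h, map_sum]
    refine Finset.sum_congr rfl fun m _ => ?_
    rw [map_mul, map_pow, AdjoinRoot.mk_C, AdjoinRoot.mk_X]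
  have hdvd : P ∣ q := AdjoinRoot.mk_eq_zero.1 hq
  have hq0 : q = 0 := by
    by_contra hq0
    refine (monic d u).not_dvd_of_degree_lt hq0 ?_ hdvd
    rw [degree_X_pow_sub_C (Nat.pos_of_ne_zero (NeZero.ne d))]
    refine lt_of_le_of_lt (degree_sum_le _ _) ((Finset.sup_lt_iff (WithBot.bot_lt_coe d)).2 fun m _ => ?_)
    exact (degree_C_mul_X_pow_le _ _).trans_lt (WithBot.coe_lt_coe.2 m.val_lt)
  intro m
  have hcoeff : q.coeff m.val = c m := by
    simp only [q, finsetSum_coeff, coeff_C_mul_X_pow]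
    rw [Finset.sum_eq_single m]
    · rw [if_pos rfl]
    · intro m' _ hm'
      rw [if_neg]
      exact fun h => hm' ((ZMod.val_injective d h).symm)
    · intro hm; exact absurd (Finset.mem_univ m) hm
  rw [← hcoeff, hq0, coeff_zero]

/-- **Existence of the normal form**: every element of `S̃` is `∑_{m} c_m w^{m}` (`0 ≤ m < d`). [folklore] -/
theorem exists_coeff [Nontrivial S] (x : AdjoinRoot (X ^ d - C u : S[X])) :
    ∃ c : ZMod d → S,
      x = ∑ m : ZMod d, AdjoinRoot.of (X ^ d - C u : S[X]) (c m) * AdjoinRoot.root (X ^ d - C u : S[X]) ^ m.val := by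
  obtain ⟨q, rfl⟩ := AdjoinRoot.mk_surjective x
  have hqr : AdjoinRoot.mk (X ^ d - C u : S[X]) q = AdjoinRoot.mk (X ^ d - C u : S[X]) (q %ₘ (X ^ d - C u)) := by
    rw [AdjoinRoot.mk_eq_mk]
    exact ⟨q /ₘ (X ^ d - C u), sub_eq_of_eq_add' (modByMonic_add_div q (X ^ d - C u)).symm⟩
  have hP1 : (X ^ d - C u : S[X]) ≠ 1 := by
    intro h1
    have h := congrArg natDegree h1
    rw [natDegree_X_pow_sub_C, natDegree_one] at h
    exact NeZero.ne d h
  have hdeg : (q %ₘ (X ^ d - C u)).natDegree < d := by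
    have h := natDegree_modByMonic_lt q (monic d u) hP1
    rwa [natDegree_X_pow_sub_C] at h
  refine ⟨fun m => (q %ₘ (X ^ d - C u)).coeff m.val, ?_⟩
  have hsum : AdjoinRoot.mk (X ^ d - C u : S[X]) (q %ₘ (X ^ d - C u)) =
      ∑ m : ZMod d, AdjoinRoot.of (X ^ d - C u : S[X]) ((q %ₘ (X ^ d - C u)).coeff m.val) *
        AdjoinRoot.root (X ^ d - C u : S[X]) ^ m.val := by
    conv_lhs => rw [as_sum_range' _ d hdeg]
    rw [map_sum]
    -- reindex `range d` by `ZMod d`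
    symm
    refine Finset.sum_nbij (fun m : ZMod d => m.val) (fun m _ => Finset.mem_range.2 m.val_lt)
      (fun m _ m' _ h => ZMod.val_injective d h) (fun j hj => ?_) (fun m _ => ?_)
    · refine ⟨(j : ZMod d), Finset.mem_coe.2 (Finset.mem_univ _), ?_⟩
      exact ZMod.val_cast_of_lt (Finset.mem_range.1 (Finset.mem_coe.1 hj))
    · rw [← C_mul_X_pow_eq_monomial, map_mul, map_pow, AdjoinRoot.mk_C, AdjoinRoot.mk_X]
  rw [hqr]
  exact hsum

/-! ### The `A × ZMod d`-grading -/

variable (a b : A) (hu : u ∈ 𝒮 b) (hab : d • a = b)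

omit [DecidableEq A] [GradedAlgebra 𝒮] [NeZero d] in
/-- Degree bookkeeping for products without carry. [folklore] -/
theorem deg_add_of_lt (i i' : A) (m m' : ZMod d) (h : m.val + m'.val < d) :
    (i - m.val • a) + (i' - m'.val • a) = (i + i') - (m + m').val • a := by
  rw [ZMod.val_add_of_lt h, add_nsmul]; abel

include hab in
omit [DecidableEq A] [GradedAlgebra 𝒮] in
/-- Degree bookkeeping for products with carry (`w^{m+m'} = u · w^{m+m'-d}`). [folklore] -/
theorem deg_add_of_le (i i' : A) (m m' : ZMod d) (h : d ≤ m.val + m'.val) :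
    (i - m.val • a) + (i' - m'.val • a) + b = (i + i') - (m + m').val • a := by
  have hv : m.val + m'.val = (m + m').val + d := ZMod.val_add_val_of_le h
  have hsm : m.val • a + m'.val • a = (m + m').val • a + b := by rw [← add_nsmul, hv, add_nsmul, hab]
  have : (i - m.val • a) + (i' - m'.val • a) + b = (i + i') - (m.val • a + m'.val • a) + b := by abel
  rw [this, hsm]; abel

include hu hab in
/-- **The `A × ZMod d`-grading of `S̃ = S[w]/(w^d − u)`** (`u ∈ S_b`, `d • a = b`): pieces
`S̃_{(i,m)} = {c · w^{m} : c ∈ S_{i − m•a}}` (`0 ≤ m < d` the canonical representative), a `GradedAlgebra`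
structure, and their description (existential package). [folklore; cite: SGA3, Exp. VIII §4–5] -/
theorem exists_rootGrading [Nontrivial S] :
    ∃ (𝒯 : A × ZMod d → Submodule k (AdjoinRoot (X ^ d - C u : S[X]))) (_ : GradedAlgebra 𝒯),
      ∀ (p : A × ZMod d) (x : AdjoinRoot (X ^ d - C u : S[X])), x ∈ 𝒯 p ↔
        ∃ c ∈ 𝒮 (p.1 - p.2.val • a),
          x = AdjoinRoot.of (X ^ d - C u : S[X]) c * AdjoinRoot.root (X ^ d - C u : S[X]) ^ p.2.val := by
  classical
  set P : S[X] := X ^ d - C u with hP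
  set of := AdjoinRoot.of P with hof
  set w := AdjoinRoot.root P with hw
  -- the pieces: image of `S_{i - m•a}` under `c ↦ of c * w^m`
  let L : ZMod d → S →ₗ[k] AdjoinRoot P := fun m =>
    { toFun := fun c => of c * w ^ m.val
      map_add' := fun c c' => by rw [map_add, add_mul]
      map_smul' := fun r c => by
        simp only [RingHom.id_apply, Algebra.smul_def, map_mul, mul_assoc]
        rw [IsScalarTower.algebraMap_apply k S (AdjoinRoot P) r, AdjoinRoot.algebraMap_eq] }
  let 𝒯 : A × ZMod d → Submodule k (AdjoinRoot P) := fun p => (𝒮 (p.1 - p.2.val • a)).map (L p.2)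
  have hL : ∀ m c, L m c = of c * w ^ m.val := fun m c => rfl
  have h𝒯 : ∀ (p : A × ZMod d) (x : AdjoinRoot P), x ∈ 𝒯 p ↔
      ∃ c ∈ 𝒮 (p.1 - p.2.val • a), x = of c * w ^ p.2.val := by
    intro p x
    simp only [𝒯, Submodule.mem_map]
    constructor
    · rintro ⟨c, hc, rfl⟩; exact ⟨c, hc, hL _ _⟩
    · rintro ⟨c, hc, rfl⟩; exact ⟨c, hc, hL _ _⟩
  have hwd : w ^ d = of u := root_pow_eq d u
  -- graded monoid
  haveI hmon : SetLike.GradedMonoid 𝒯 :=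
    { one_mem := by
        rw [h𝒯]
        refine ⟨1, ?_, by rw [map_one, one_mul, Prod.snd_zero, ZMod.val_zero, pow_zero]⟩
        rw [Prod.fst_zero, Prod.snd_zero, ZMod.val_zero, zero_nsmul, sub_zero]
        exact SetLike.one_mem_graded 𝒮
      mul_mem := by
        rintro ⟨i, m⟩ ⟨i', m'⟩ x y hx hy
        obtain ⟨c, hc, rfl⟩ := (h𝒯 _ _).1 hx
        obtain ⟨c', hc', rfl⟩ := (h𝒯 _ _).1 hy
        rw [h𝒯]
        by_cases hlt : m.val + m'.val < d
        · refine ⟨c * c', ?_, ?_⟩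
          · show c * c' ∈ 𝒮 ((i + i') - (m + m').val • a)
            rw [← deg_add_of_lt d a i i' m m' hlt]; exact SetLike.mul_mem_graded hc hc'
          · show of c * w ^ m.val * (of c' * w ^ m'.val) = of (c * c') * w ^ (m + m').val
            rw [ZMod.val_add_of_lt hlt, map_mul, pow_add]; ring
        · have hle : d ≤ m.val + m'.val := not_lt.1 hlt
          have hv : m.val + m'.val = (m + m').val + d := ZMod.val_add_val_of_le hle
          refine ⟨c * c' * u, ?_, ?_⟩
          · show c * c' * u ∈ 𝒮 ((i + i') - (m + m').val • a)
            rw [← deg_add_of_le d a b hab i i' m m' hle]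
            exact SetLike.mul_mem_graded (SetLike.mul_mem_graded hc hc') hu
          · show of c * w ^ m.val * (of c' * w ^ m'.val) = of (c * c' * u) * w ^ (m + m').val
            calc of c * w ^ m.val * (of c' * w ^ m'.val) = of (c * c') * w ^ (m.val + m'.val) := by
                  rw [map_mul, pow_add]; ring
              _ = of (c * c' * u) * w ^ (m + m').val := by
                  rw [hv, pow_add, hwd, map_mul, map_mul, map_mul]; ring }
  -- independence: read off one homogeneous component of one coefficient
  have hindep : iSupIndep 𝒯 := by
    rw [iSupIndep_iff_finsetSum_eq_zero_imp_eq_zero]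
    intro s v hv hsum p₀ hp₀
    choose! c hc hvc using fun p (hp : p ∈ s) => (h𝒯 p (v p)).1 (hv p hp)
    -- regroup the relation by the exponent of `w`
    let Cf : ZMod d → S := fun m => ∑ p ∈ s with p.2 = m, c p
    have hrel : ∑ m : ZMod d, of (Cf m) * w ^ m.val = 0 := by
      rw [← hsum, ← Finset.sum_fiberwise_of_maps_to (g := fun p : A × ZMod d => p.2)
        (fun p _ => Finset.mem_univ p.2)]
      refine Finset.sum_congr rfl fun m _ => ?_
      rw [map_sum, Finset.sum_mul]
      refine Finset.sum_congr rfl fun p hp => ?_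
      obtain ⟨hps, hpm⟩ := Finset.mem_filter.1 hp
      rw [hvc p hps, hpm]
    have hC0 : ∀ m, Cf m = 0 := coeff_eq_zero_of_sum_eq_zero d u Cf hrel
    -- the component of degree `p₀.1 - p₀.2.val • a` of `Cf p₀.2` is `c p₀`
    have hcomp : (decompose 𝒮 (Cf p₀.2) (p₀.1 - p₀.2.val • a) : S) = c p₀ := by
      rw [← GradedRing.proj_apply, show Cf p₀.2 = ∑ p ∈ s with p.2 = p₀.2, c p from rfl, map_sum,
        Finset.sum_eq_single p₀]
      · rw [GradedRing.proj_apply]; exact decompose_of_mem_same 𝒮 (hc p₀ hp₀)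
      · intro p hp hpp₀
        obtain ⟨hps, hpm⟩ := Finset.mem_filter.1 hp
        rw [GradedRing.proj_apply]
        refine decompose_of_mem_ne 𝒮 (hc p hps) fun h => hpp₀ ?_
        rw [hpm] at h
        exact Prod.ext (sub_left_injective h) hpm
      · intro h
        exact (h (Finset.mem_filter.2 ⟨hp₀, rfl⟩)).elim
    have hc0 : c p₀ = 0 := by rw [← hcomp, hC0, decompose_zero]; simp
    rw [hvc p₀ hp₀, hc0, map_zero, zero_mul]
  -- spanning: normal form, then decompose each coefficient
  have htop : ⨆ p, 𝒯 p = ⊤ := by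
    rw [eq_top_iff]
    rintro x -
    obtain ⟨c, rfl⟩ := exists_coeff d u x
    refine Submodule.sum_mem _ fun m _ => ?_
    rw [← sum_support_decompose 𝒮 (c m), map_sum, Finset.sum_mul]
    refine Submodule.sum_mem _ fun i _ => Submodule.mem_iSup_of_mem (i + m.val • a, m) ((h𝒯 _ _).2 ?_)
    refine ⟨_, ?_, rfl⟩
    show (decompose 𝒮 (c m) i : S) ∈ 𝒮 (i + m.val • a - m.val • a)
    rw [add_sub_cancel_right]; exact SetLike.coe_mem _
  have hint : DirectSum.IsInternal 𝒯 :=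
    (DirectSum.isInternal_submodule_iff_iSupIndep_and_iSup_eq_top _).2 ⟨hindep, htop⟩
  exact ⟨𝒯, { hmon with toDecomposition := hint.chooseDecomposition }, h𝒯⟩

/-! ### Properties of the root-adjunction chart (pieces given by their description) -/

section Properties

variable (𝒯 : A × ZMod d → Submodule k (AdjoinRoot (X ^ d - C u : S[X])))
  (h𝒯 : ∀ (p : A × ZMod d) (x : AdjoinRoot (X ^ d - C u : S[X])), x ∈ 𝒯 p ↔
    ∃ c ∈ 𝒮 (p.1 - p.2.val • a),
      x = AdjoinRoot.of (X ^ d - C u : S[X]) c * AdjoinRoot.root (X ^ d - C u : S[X]) ^ p.2.val)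
include h𝒯

omit [DecidableEq A] [GradedAlgebra 𝒮] [NeZero d] in
/-- `S_i ⊆ S̃_{(i,0)}`. [folklore] -/
theorem of_mem {i : A} {c : S} (hc : c ∈ 𝒮 i) : AdjoinRoot.of (X ^ d - C u : S[X]) c ∈ 𝒯 (i, 0) := by
  rw [h𝒯]
  exact ⟨c, by rw [ZMod.val_zero, zero_nsmul, sub_zero]; exact hc, by rw [ZMod.val_zero, pow_zero, mul_one]⟩

omit [NeZero d] in
/-- `w ∈ S̃_{(a,1)}` (`d ≥ 2`). [folklore] -/
theorem root_mem [Fact (1 < d)] : AdjoinRoot.root (X ^ d - C u : S[X]) ∈ 𝒯 (a, 1) := by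
  rw [h𝒯]
  refine ⟨1, ?_, by rw [map_one, one_mul, ZMod.val_one, pow_one]⟩
  rw [ZMod.val_one, one_nsmul, sub_self]
  exact SetLike.one_mem_graded 𝒮

omit [DecidableEq A] [GradedAlgebra 𝒮] [NeZero d] in
/-- **The degree-`(0,0)` part is `S_0`**: `x ∈ S̃_0 ↔ x = c` with `c ∈ S_0`. [folklore] -/
theorem mem_zero_iff (x : AdjoinRoot (X ^ d - C u : S[X])) :
    x ∈ 𝒯 0 ↔ ∃ c ∈ 𝒮 0, x = AdjoinRoot.of (X ^ d - C u : S[X]) c := by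
  rw [h𝒯, Prod.fst_zero, Prod.snd_zero, ZMod.val_zero, zero_nsmul, sub_zero, pow_zero]
  simp only [mul_one]

omit [DecidableEq A] [GradedAlgebra 𝒮] in
/-- **Same invariants: `S_0 ≃+* S̃_{(0,0)}`** compatibly with `of`. [folklore] -/
theorem exists_ringEquiv_gradeZero [Nontrivial S] [SetLike.GradedMonoid 𝒮] [SetLike.GradedMonoid 𝒯] :
    ∃ e : 𝒮 0 ≃+* 𝒯 0, ∀ x : 𝒮 0, (e x : AdjoinRoot (X ^ d - C u : S[X])) = AdjoinRoot.of (X ^ d - C u : S[X]) x := by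
  classical
  have hto : ∀ x : 𝒮 0, AdjoinRoot.of (X ^ d - C u : S[X]) x ∈ 𝒯 0 := fun x =>
    (mem_zero_iff 𝒮 d u a 𝒯 h𝒯 _).2 ⟨x, x.2, rfl⟩
  have hfrom : ∀ y : 𝒯 0, ∃ c ∈ 𝒮 0, (y : AdjoinRoot (X ^ d - C u : S[X])) = AdjoinRoot.of (X ^ d - C u : S[X]) c :=
    fun y => (mem_zero_iff 𝒮 d u a 𝒯 h𝒯 _).1 y.2
  choose g hg0 hg using hfrom
  have hinj := of_injective d u
  have hleft : ∀ x : 𝒮 0, g ⟨_, hto x⟩ = (x : S) := fun x => hinj ((hg ⟨_, hto x⟩).symm.trans rfl)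
  refine ⟨{ toFun := fun x => ⟨_, hto x⟩
            invFun := fun y => ⟨g y, hg0 y⟩
            left_inv := fun x => Subtype.ext (hleft x)
            right_inv := fun y => Subtype.ext ((hg y).symm)
            map_mul' := fun x y => Subtype.ext (by simp)
            map_add' := fun x y => Subtype.ext (by simp) }, fun x => rfl⟩

omit [DecidableEq A] [GradedAlgebra 𝒮] [NeZero d] in
/-- A piece `S̃_{(i,m)}` lies in an ideal `𝔔̃` as soon as `of (S_{i − m•a}) ⊆ 𝔔̃`. [folklore] -/
theorem mem_of_forall_mem (𝔔 : Ideal (AdjoinRoot (X ^ d - C u : S[X]))) (p : A × ZMod d)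
    (hp : ∀ c ∈ 𝒮 (p.1 - p.2.val • a), AdjoinRoot.of (X ^ d - C u : S[X]) c ∈ 𝔔)
    (x : AdjoinRoot (X ^ d - C u : S[X])) (hx : x ∈ 𝒯 p) : x ∈ 𝔔 := by
  obtain ⟨c, hc, rfl⟩ := (h𝒯 p x).1 hx
  exact 𝔔.mul_mem_right _ (hp c hc)

end Properties

/-! ### Size -/

/-- `S̃` is free over `S`. [folklore] -/
theorem module_free : Module.Free S (AdjoinRoot (X ^ d - C u : S[X])) := (monic d u).free_adjoinRoot

/-- `S̃` is finite over `S`. [folklore] -/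
theorem module_finite : Module.Finite S (AdjoinRoot (X ^ d - C u : S[X])) := (monic d u).finite_adjoinRoot

/-- `S̃` is of finite type over `k` when `S` is. [folklore] -/
theorem finiteType [Algebra.FiniteType k S] : Algebra.FiniteType k (AdjoinRoot (X ^ d - C u : S[X])) := by
  haveI := module_finite d u
  haveI : Algebra.FiniteType S (AdjoinRoot (X ^ d - C u : S[X])) := Module.Finite.finiteType _
  exact Algebra.FiniteType.trans (S := S) inferInstance inferInstance

/-- `S̃` is Noetherian when `S` is. [folklore] -/
theorem isNoetherianRing [IsNoetherianRing S] : IsNoetherianRing (AdjoinRoot (X ^ d - C u : S[X])) := by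
  haveI := module_finite d u
  haveI : Algebra.FiniteType S (AdjoinRoot (X ^ d - C u : S[X])) := Module.Finite.finiteType _
  exact Algebra.FiniteType.isNoetherianRing S _

end Summit.ResolutionOfSingularities.ResolutionOfSingularities.Theorems.FRationalResolution.RootAdjoinChart

end
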